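import Literature.MathematicalPhysics.QuantumFieldTheory.Balaban1983to89.B9RWSums346MixedFactorAtPinsClosed
import Literature.MathematicalPhysics.QuantumFieldTheory.Balaban1983to89.B9RWSums347DefiniteFaces

/-!
# `Balaban1983to89.B9RWSums346MixedFactorAtRecord` — T. Bałaban, *Propagators for lattice gauge theories in a background field*, Commun. Math. Phys. **99**
# (1985) 389–434 [Balaban1985BackgroundPropagators] (3.88)–(3.89) p. 409 ∕ (3.46) p. 398 ∕ Cor 3.6 p. 408, with [Balaban1984PropagatorsII] Lemma 2.1 (2.59)–(2.61)
# pp. 233–234: ★★★ **ROWS 18's THIRD-ORDER MIXED FACTOR SCHEMA `FactorsL2Mixed37Dir` AT THE RECORD** — this seat's member-level theorem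
# `factorsL2Mixed37Dir_memberY_at` (g1, `…MixedFactorAtPinsClosed`) with its two Lemma-2.1 inputs (`Facts347`, `Ineq261`) DISCHARGED at def-Y's geometry of record
# `geo9Y` (n06-i ∕ n06-j: `B9RWSums347DefiniteFaces.facts347_exp261_geo9Y`, `ineq261_exp261_geo9Y`) and its constant made MEMBER-UNIFORM (`Sizes.Bounded`)

statement-level skeleton of published theorems with citation tags; proofs where landed; nothing here is a claim about the Yang–Mills mass gap

THE PRINT.  (3.88)–(3.89) p. 409: *«Δ′_aG′₀ = I − Σ_□K(h_□)G′_□h_□ = I − R′ … The operator K(h_□)G_□h_□ satisfies the inequality (3.89), hence it is small»*;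
(3.46) p. 398 (the six block estimates of `G′(U)`), Cor 3.6 p. 408 («constants independent of □»); [4] Lemma 2.1 p. 233–234: *«for RM satisfying (2.59) …
sup_{y∈𝔅} Σ_{y′∈𝔅} e^{−αδ₀d(y,y′)} ≤ c₁(α), (2.61)»*; p. 398: *«the global inequalities (3.47) are consequences of the local ones (3.42) and Lemma 2.1»*.

WHY THIS FILE (cell `pub-ymgap`, Track A node N06 [B9], rows 18; width seat `pub-ymgap-dag-n06-w7`, g2, 2026-08-28).  The N06 certificate (dag-n06-d, edition 41
`…N06AtOpsYNuOfRecordV6EPairNV`) still DISPLAYS, as the last conjunct of its rows-18 binder `h36H`, the schema `FactorsL2Mixed37Dir (𝔬 x) (𝔡 x) (𝔩 x) 1 (H x) pM.θM p.δ₀ U`,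
while (since edition 40) the two letter transposes `Pᵗ∕P`, `Cᵗ∕C` are displayed INSIDE `h36H` and `Identities₂ (𝔬 x) (𝔡 x) (𝔩 x) 1 (H x) U` is `h36`'s second conjunct.  The g1 theorem
`factorsL2Mixed37Dir_memberY_at` derives the schema from exactly these + the pins, but still asks, per member, for the two Lemma-2.1 facts `Facts347 (geo9Y x) R₀ H₀ dF δ α L₀`
and `Ineq261 d₁ (toB6 (geo9Y x) R₀ H₀) δ_L α₁` at free rates, and its constant carries the member's letter sizes `κ`.  THIS FILE closes both gaps so that the knit is ONE call:
* §1 ★ `lemma21_geo9Y_record` — the two facts at the geometry of record ABOVE ONE THRESHOLD, at FIXED bookkeeping rates (transfer margin `α = ½, δ = 1`; legs' rate `δ_L`,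
  `α₁ = ½`), UNIFORM IN THE TRANSPORT LETTER `H₀` (`toB6`'s `Hyp21_22` field is read by neither (2.60), (2.61) nor the size condition; `R₀ = 1`).
* §2 ★★★ `factorsL2Mixed37Dir_memberY_record` — `∃ M_K a_K B_K δ_K > 0` (on `d ℓ b₀ b₁ M⋆ N c₀`): for `G ≤ U(N)`, every member with `M_K ≤ M_x`, `α₀ > 0`, `c₀·M_x·α₀ ≤ a_K`,
  `U` in (3.35), faithful `bI`, ANY `H₀`, ANY walk-letter records `𝔬 𝔡 𝔩` over the cubes with the five pins, the DISPLAYED `StaticOK 𝔬 ρ Nn N′ C_ℓ κ`, `κ.Bounded K_c θ₀ C_ℓ M_x`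
  (`θ₀ ≥ 0`, `C_ℓ ≥ 1`), `Identities₂ 𝔬 𝔡 𝔩 1 H₀ U` and the two transposes IN THE CERTIFICATE's ORDER (`Pᵗ∕P`, `Cᵗ∕C`), at any target rate `0 ≤ ρ′ ≤ δ_K`:
  `FactorsL2Mixed37Dir 𝔬 𝔡 𝔩 1 H₀ (θ₀ · e^{(3/4 + ρ′)ρ} · B_K) ρ′ U` — the sizes' `O(1)` `θ₀` of (3.89) times a constant; no Lemma-2.1 binder, no member datum left.
NET FOR THE KNIT: the sequel `…AtRecordClosed` names `M_K a_K B_K δ_K`; the Theorems-side helper `BalabanUVNodesN06MixedFactorAtPinsPhys` reads this at `c₀ := c35Y`,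
`G := SU(N)`, `θ₀ := p.θ₀`, `ρ := p.ρ`, `ρ′ := p.δ₀` in `h36H`'s own regime prefix.

HONEST SCOPE.  Composition over landed modules (`factorsL2Mixed37Dir_memberY_at`, `_uniform_of_bounded`, `_mono`, `facts347_exp261_geo9Y`, `ineq261_exp261_geo9Y`);
`Identities₂`, the transposes, `StaticOK`, `Sizes.Bounded` are HYPOTHESES where used; the legs are theorems (dag-n06-w1's cube estimates through g0∕g1's readings); nothing
of [B9] asserted beyond kernel-checked parents; COUNT-NEUTRAL; N06 NOT discharged; K1⁹ NOT closed; nothing continuum ∕ OS ∕ mass gap ∕ Clay.  NEW file; 0 `def`.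
-/

noncomputable section

namespace Literature.MathematicalPhysics.QuantumFieldTheory.Balaban1983to89.B9RWSums346MixedFactorAtRecord

open Literature.MathematicalPhysics.QuantumFieldTheory.Balaban1983to89
open Node00 B6KLevelCensusIndexV1 B6Geom246MultiLevelBox B6MultiLevelTorusOperator B6GlobalChartV1 B9BackgroundsKLevelV1 B6Geom246MultiLevelTorus
open Literature.MathematicalPhysics.QuantumFieldTheory.Balaban1983to89.B6Ineq2142KLevelV1 (lvl β)
open Literature.MathematicalPhysics.QuantumFieldTheory.Balaban1983to89.B6RandomWalk (Ineq261 c1_nonneg)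
open Literature.MathematicalPhysics.QuantumFieldTheory.Balaban1983to89.B9Ineq349SiteComposite (cdSL cdsSL)
open Literature.MathematicalPhysics.QuantumFieldTheory.Balaban1983to89.B9CoReadingCoords (coordOpK)
open Literature.MathematicalPhysics.QuantumFieldTheory.Balaban1983to89.B9CoReadingCoordsS (XSK blkSK sIK)
open Literature.MathematicalPhysics.QuantumFieldTheory.Balaban1983to89.B9CoReadingCoordsTranspose (TrIdx trBasis)
open Literature.MathematicalPhysics.QuantumFieldTheory.Balaban1983to89.B9Thm34Ext (toB6)
open Literature.MathematicalPhysics.QuantumFieldTheory.Balaban1983to89.B9PinMembersKLevelV1 (MemberY geo9Y bg9Y)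
open Literature.MathematicalPhysics.QuantumFieldTheory.Balaban1983to89.B9Thm37Sum (mulOp)
open Literature.MathematicalPhysics.QuantumFieldTheory.Balaban1983to89.B9Thm37Glue (IsTransposePair)
open Literature.MathematicalPhysics.QuantumFieldTheory.Balaban1983to89.B9Thm37Whole (Ops StaticOK Sizes)
open Literature.MathematicalPhysics.QuantumFieldTheory.Balaban1983to89.B9Thm37WholeDir (DirLetters37 Identities₂)
open Literature.MathematicalPhysics.QuantumFieldTheory.Balaban1983to89.B9Thm37KLetterDir (FactorsL2Mixed37Dir)
open Literature.MathematicalPhysics.QuantumFieldTheory.Balaban1983to89.B9RWSums346SecondDiffGp (DirOps37)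
open Literature.MathematicalPhysics.QuantumFieldTheory.Balaban1983to89.B9RWSums343to347Whole (Facts347)
open Literature.MathematicalPhysics.QuantumFieldTheory.Balaban1983to89.B6Cover236MultiLevelBlocks (cubes)
open Literature.MathematicalPhysics.QuantumFieldTheory.Balaban1983to89.B9WalkLettersCoordsS (hWalkY gsqcoS)
open Literature.MathematicalPhysics.QuantumFieldTheory.Balaban1983to89.B9RWSums346MixedFactorAtPins (factorsL2Mixed37Dir_mono factorsL2Mixed37Dir_uniform_of_bounded)
open Literature.MathematicalPhysics.QuantumFieldTheory.Balaban1983to89.B9RWSums346MixedFactorAtPinsClosed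
  (MFac aFac BFac δFac MFac_pos aFac_pos BFac_pos δFac_pos factorsL2Mixed37Dir_memberY_at)
open Literature.MathematicalPhysics.QuantumFieldTheory.Balaban1983to89.B9RWSums347DefiniteFaces (exp261 facts347_exp261_geo9Y ineq261_exp261_geo9Y)
open scoped Matrix Matrix.Norms.L2Operator

section StageY

variable (d ℓ : ℕ) (hd : 1 ≤ d + 1) (hL : Odd (ℓ + 1) ∧ 1 < ℓ + 1) (b₀ b₁ : ℝ) (Mstar : ℕ)
variable [∀ x : MemberY d ℓ hd hL b₀ b₁ Mstar, Fintype (geo9Y x).Site]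

/-! ## §1 The two Lemma-2.1 inputs at the geometry of record, above one threshold, uniform in the transport letter `H₀` -/

/-- ★ **[4] (2.61) AT THE LEGS' RATE AND THE (3.47)-PASSAGE FACTS AT THE TRANSFER RATE, AT `geo9Y`, ABOVE ONE THRESHOLD, FOR EVERY `H₀`**: for `δ_L > 0` there are `M_th` and
door exponents `d₁`, `d_F` with, for every member above `M_th` and every `H₀`, `Ineq261 d₁ (toB6 (geo9Y x) 1 H₀) δ_L ½` and `Facts347 (geo9Y x) 1 H₀ d_F 1 ½ (ℓ + 1)` — n06-i's ∕
n06-j's record facts (`ineq261_exp261_geo9Y`, `facts347_exp261_geo9Y`) at fixed rates; `H₀`-uniform because `toB6`'s `Hyp21_22` enters neither (2.60), (2.61) nor the size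
condition (the facts at `H₀ := True` ARE the facts at any `H₀`, field by field). [cite: Balaban1984PropagatorsII, Lemma 2.1 (2.59)–(2.61) pp.233–234; Balaban1985BackgroundPropagators, p.398 remark after (3.47)] -/
theorem lemma21_geo9Y_record {δL : ℝ} (hδL : 0 < δL) :
    ∃ (Mth : ℝ) (d₁ dF : ℕ), ∀ (H₀ : Prop) (x : MemberY d ℓ hd hL b₀ b₁ Mstar), Mth ≤ (geo9Y x).M →
      Ineq261 d₁ (toB6 (geo9Y x) 1 H₀) δL (1 / 2) ∧ Facts347 (geo9Y x) 1 H₀ dF 1 (1 / 2) ((ℓ + 1 : ℕ) : ℝ) := by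
  obtain ⟨ML, h261⟩ := ineq261_exp261_geo9Y (d := d) (ℓ := ℓ) (hd := hd) (hL := hL) (b₀ := b₀) (b₁ := b₁) (Mstar := Mstar)
    (fun _ => (1 : ℝ)) (fun _ => True) (δ₀ := δL) (α := 1 / 2) (by positivity)
  obtain ⟨Mg, hF⟩ := facts347_exp261_geo9Y (d := d) (ℓ := ℓ) (hd := hd) (hL := hL) (b₀ := b₀) (b₁ := b₁) (Mstar := Mstar)
    (fun _ => True) (α := 1 / 2) (by norm_num) (by norm_num) (δ := 1) one_pos
  have e : (1 : ℝ) - 1 / 2 = 1 / 2 := by norm_num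
  rw [e] at hF
  -- `toB6`'s transport letter `Hyp21_22` is read by neither (2.60), (2.61) nor the size condition: the `True` facts ARE the `H₀` facts
  exact ⟨max ML Mg, _, _, fun H₀ x hM => ⟨h261 x ((le_max_left _ _).trans hM),
    have h := hF x ((le_max_right _ _).trans hM)
    ⟨h.one_le_L, h.L_le, h.eta_pos, h.h260, h.h261, h.size⟩⟩⟩

/-! ## §2 The schema at the record: Lemma-2.1 inputs discharged, constant member-uniform, transposes in the certificate's order -/

/-- ★★★ **ROWS 18's `FactorsL2Mixed37Dir` AT THE RECORD** (module docstring): `∃ M_K a_K B_K δ_K > 0` such that for `G ≤ U(N)`, every member `x` with `M_K ≤ M_x`, `α₀ > 0`,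
`c₀·M_x·α₀ ≤ a_K`, `U ∈ (bg9Y…).Reg335 c₀ α₀`, a faithful `bI`, ANY `H₀`, ANY walk-letter records over the cubes with the five pins (`𝔬.blk`, `𝔬.h = hWalkY`, `𝔬.Gsq = gsqcoS`,
`𝔡.Dd ∕ 𝔡.Dsd` = the scaled coordinate models), the displayed `StaticOK 𝔬 ρ Nn N′ C_ℓ κ`, `κ.Bounded K_c θ₀ C_ℓ M_x` with `0 ≤ θ₀`, `1 ≤ C_ℓ`, `Identities₂ 𝔬 𝔡 𝔩 1 H₀ U`, the
transposes `∀ c ν, IsTransposePair (𝔩.Pt U c ν) (𝔩.P U c ν)`, `∀ c, IsTransposePair (𝔬.Ct U c) (𝔬.Cop U c)`, and any `0 ≤ ρ′ ≤ δ_K`: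
`FactorsL2Mixed37Dir 𝔬 𝔡 𝔩 1 H₀ (θ₀ * exp ((3/4 + ρ′)ρ) * B_K) ρ′ U`.  Proof: §1 at `δ_L := δFac` feeds `factorsL2Mixed37Dir_memberY_at` (margin `αδ = ½`, `α₁ = ½`,
`ρ′ ≤ δFac∕2`), then `_uniform_of_bounded` (`M_x ≥ 1`) and `_mono` to the displayed product form.
[cite: Balaban1985BackgroundPropagators, (3.88)–(3.89) p.409, (3.46) p.398, Cor 3.6 p.408, (3.35) p.396; Balaban1984PropagatorsII, (2.39)–(2.44) pp.229–230, (2.52)–(2.55) p.232, Lemma 2.1 (2.59)–(2.61) pp.233–234] -/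
theorem factorsL2Mixed37Dir_memberY_record (N : ℕ) [NeZero N] {c₀ : ℝ} (hc₀ : 0 < c₀) :
    ∃ MK aK BK δK : ℝ, 0 < MK ∧ 0 < aK ∧ 0 < BK ∧ 0 < δK ∧
      ∀ {G : Subgroup (Matrix (Fin N) (Fin N) ℂ)ˣ} (_ : G ≤ B7Prop2Explicit.unitaryUnits (Matrix (Fin N) (Fin N) ℂ))
        (x : MemberY d ℓ hd hL b₀ b₁ Mstar), MK ≤ (geo9Y x).M → ∀ α₀ : ℝ, 0 < α₀ → c₀ * (geo9Y x).M * α₀ ≤ aK →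
      ∀ (U : (bg9Y (Matrix (Fin N) (Fin N) ℂ) G x).Cfg), (bg9Y (Matrix (Fin N) (Fin N) ℂ) G x).Reg335 c₀ α₀ U →
      ∀ {bI : FBondY x.toKIdx → IBondY x.toKIdx} (_ : ∀ f, lvl x.hN x.D x.hk (bI f) = (blkV1 x.hN x.D f).1.1)
        (_ : ∀ f, (geomT x.D).dist (β x.hN x.D x.hk (bI f)) (blkV1 x.hN x.D f) ≤ 1) (H₀ : Prop) [DecidableEq (geo9Y x).Site]
        {Y : Type} [Fintype Y] (𝔬 : Ops (geo9Y x) (bg9Y (Matrix (Fin N) (Fin N) ℂ) G x) (XSK (TrIdx N) x.toKIdx) Y ↥(cubes x.toKIdx.D.toDomains))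
        (𝔡 : DirOps37 𝔬 (Fin (d + 1))) (𝔩 : DirLetters37 𝔬 (Fin (d + 1)))
        (_ : 𝔬.blk = blkSK x.toKIdx (sIK x.toKIdx bI)) (_ : ∀ c, 𝔬.h c = hWalkY x c)
        (_ : ∀ c, 𝔬.Gsq U c = gsqcoS x (trBasis N) (bg9Y (Matrix (Fin N) (Fin N) ℂ) G x) (fun U => U) (parSymY x.toKIdx) c U)
        (_ : ∀ ν, 𝔡.Dd U ν = (etaS x.toKIdx)⁻¹ • coordOpK (trBasis N) (fun _ : Fin (d + 1) => (cdSL x.toKIdx U ν).restrictScalars ℝ))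
        (_ : ∀ μ, 𝔡.Dsd U μ = (etaS x.toKIdx)⁻¹ • coordOpK (trBasis N) (fun _ : Fin (d + 1) => (cdsSL x.toKIdx U μ).restrictScalars ℝ))
        {ρ Nn N' Cℓ Kc θ₀ : ℝ} {κ : Sizes} (_ : StaticOK 𝔬 ρ Nn N' Cℓ κ) (_ : κ.Bounded Kc θ₀ Cℓ (geo9Y x).M) (_ : 0 ≤ θ₀) (_ : 1 ≤ Cℓ)
        (_ : Identities₂ 𝔬 𝔡 𝔩 1 H₀ U)
        (_ : ∀ c ν, IsTransposePair (𝔩.Pt U c ν) (𝔩.P U c ν)) (_ : ∀ c, IsTransposePair (𝔬.Ct U c) (𝔬.Cop U c))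
        {ρ' : ℝ} (_ : 0 ≤ ρ') (_ : ρ' ≤ δK),
        FactorsL2Mixed37Dir 𝔬 𝔡 𝔩 1 H₀ (θ₀ * Real.exp ((3 / 4 + ρ') * ρ) * BK) ρ' U := by
  obtain ⟨Mth, d₁, dF, hth⟩ := lemma21_geo9Y_record d ℓ hd hL b₀ b₁ Mstar (δFac_pos d ℓ hd hL b₀ b₁ Mstar N c₀ hc₀)
  -- the member-uniform constant: `B_K := max 1 (BFac · c₁ · ((d+1)·√(L₀^{|1|}) + √(L₀^{|2|})·L₀))`, `L₀ = ℓ + 1`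
  refine ⟨max (max (MFac d ℓ hd hL b₀ b₁ Mstar N c₀ hc₀) Mth) 1, aFac d ℓ hd hL b₀ b₁ Mstar N c₀ hc₀,
    max 1 (BFac d ℓ hd hL b₀ b₁ Mstar N c₀ hc₀ * B6.c1 d₁ (δFac d ℓ hd hL b₀ b₁ Mstar N c₀ hc₀) (1 / 2) *
      (((Fintype.card (Fin (d + 1)) : ℝ)) * Real.sqrt (((ℓ + 1 : ℕ) : ℝ) ^ |(1 : ℝ)|) + Real.sqrt (((ℓ + 1 : ℕ) : ℝ) ^ |(2 : ℝ)|) * ((ℓ + 1 : ℕ) : ℝ))),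
    δFac d ℓ hd hL b₀ b₁ Mstar N c₀ hc₀ / 2,
    lt_max_of_lt_right one_pos, aFac_pos d ℓ hd hL b₀ b₁ Mstar N c₀ hc₀, lt_max_of_lt_left one_pos,
    half_pos (δFac_pos d ℓ hd hL b₀ b₁ Mstar N c₀ hc₀), ?_⟩
  intro G hG x hM α₀ hα₀ ha U hU bI hlev hβ1 H₀ _ Y _ 𝔬 𝔡 𝔩 hblk hh hGsq hDd hDsd ρ Nn N' Cℓ Kc θ₀ κ hs hκB hθ₀ hCℓ hi hPt hCt ρ' hρ'0 hρ'
  set BF := BFac d ℓ hd hL b₀ b₁ Mstar N c₀ hc₀ with hBF_def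
  set δF := δFac d ℓ hd hL b₀ b₁ Mstar N c₀ hc₀ with hδF_def
  have hBF : 0 < BF := BFac_pos d ℓ hd hL b₀ b₁ Mstar N c₀ hc₀
  have hδF : 0 < δF := δFac_pos d ℓ hd hL b₀ b₁ Mstar N c₀ hc₀
  have hMF : MFac d ℓ hd hL b₀ b₁ Mstar N c₀ hc₀ ≤ (geo9Y x).M := ((le_max_left _ _).trans (le_max_left _ _)).trans hM
  have hMth : Mth ≤ (geo9Y x).M := ((le_max_right _ _).trans (le_max_left _ _)).trans hM
  have h1M : 1 ≤ (geo9Y x).M := (le_max_right _ _).trans hM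
  obtain ⟨h261, hF⟩ := hth H₀ x hMth
  have hαδ : (0 : ℝ) ≤ 1 / 2 * 1 := by norm_num
  have hrate : ρ' ≤ (1 - 1 / 2) * δF := by rw [hδF_def]; linarith
  -- g1's member-level theorem at the record's Lemma-2.1 facts, transposes re-ordered
  have key := factorsL2Mixed37Dir_memberY_at d ℓ hd hL b₀ b₁ Mstar N c₀ hc₀ hG x hMF α₀ hα₀ ha U hU hlev hβ1 1 H₀ 𝔬 𝔡 𝔩 hblk hh hGsq hDd hDsd
    hs hκB.nonneg hF hαδ hδF le_rfl h261 hρ'0 hrate hi (fun c ν => (hPt c ν).symm) (fun c => (hCt c).symm)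
  -- the letter sizes leave the constant (`κ.Bounded`, `M_x ≥ 1`, `C_ℓ ≥ 1`)
  have hL₀ : (0 : ℝ) ≤ ((ℓ + 1 : ℕ) : ℝ) := Nat.cast_nonneg _
  have key2 := factorsL2Mixed37Dir_uniform_of_bounded 𝔬 𝔡 𝔩 U hκB h1M hCℓ hθ₀ (Nat.cast_nonneg _) hL₀ (Real.exp_nonneg _) hBF.le
    (c1_nonneg d₁ δF (1 / 2)) hs.dnn hs.lenpos key
  -- rewrite the exponent and dominate the product by the displayed form `θ₀ · e · B_K`
  have he : Real.exp ((1 / 2 * 1 / 2 + (1 / 2 * 1 + ρ')) * ρ) = Real.exp ((3 / 4 + ρ') * ρ) := by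
    congr 1; ring
  rw [he] at key2
  refine factorsL2Mixed37Dir_mono 𝔬 𝔡 𝔩 U ?_ ?_ le_rfl hs.dnn hs.lenpos key2
  · have hc := c1_nonneg d₁ δF (1 / 2)
    positivity
  · set e := Real.exp ((3 / 4 + ρ') * ρ) with he_def
    have he0 : 0 ≤ e := Real.exp_nonneg _
    have hs1 : 0 ≤ Real.sqrt (((ℓ + 1 : ℕ) : ℝ) ^ |(1 : ℝ)|) := Real.sqrt_nonneg _
    have hs2 : 0 ≤ Real.sqrt (((ℓ + 1 : ℕ) : ℝ) ^ |(2 : ℝ)|) := Real.sqrt_nonneg _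
    have hc := c1_nonneg d₁ δF (1 / 2)
    have hnD : (0 : ℝ) ≤ (Fintype.card (Fin (d + 1)) : ℝ) := Nat.cast_nonneg _
    have hid : ((Fintype.card (Fin (d + 1)) : ℝ) * ((θ₀ * Real.sqrt (((ℓ + 1 : ℕ) : ℝ) ^ |(1 : ℝ)|) * e) * BF) +
        (θ₀ * Real.sqrt (((ℓ + 1 : ℕ) : ℝ) ^ |(2 : ℝ)|) * e) * (BF * ((ℓ + 1 : ℕ) : ℝ))) * B6.c1 d₁ δF (1 / 2) =
        θ₀ * e * (BF * B6.c1 d₁ δF (1 / 2) *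
          (((Fintype.card (Fin (d + 1)) : ℝ)) * Real.sqrt (((ℓ + 1 : ℕ) : ℝ) ^ |(1 : ℝ)|) + Real.sqrt (((ℓ + 1 : ℕ) : ℝ) ^ |(2 : ℝ)|) * ((ℓ + 1 : ℕ) : ℝ))) := by
      ring
    rw [hid]
    exact mul_le_mul_of_nonneg_left (le_max_right _ _) (mul_nonneg hθ₀ he0)

end StageY

end Literature.MathematicalPhysics.QuantumFieldTheory.Balaban1983to89.B9RWSums346MixedFactorAtRecord

end
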